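import Summits.ResolutionOfSingularities.ResolutionOfSingularities.Theses.Valuative
import Summits.ResolutionOfSingularities.ResolutionOfSingularities.Theses.CyclicCovers
import Literature.AlgebraicGeometry.Resolution.PrincipalizationToResolutionInChar
import HarnessLib

/-!
# Crux `PatchingRel` (stmt-ResolutionOfSingularities-0642), line `sandwiched-gluing` (lead c2):
# Hironaka's Principalization II in characteristic `p` already gives the crux

The crux `Valuative.PatchingRel` (= `CyclicCovers.PatchingRel`) is
`∀ p prime, LUrel_p → ResolutionInChar.{0} p`: relative local uniformization implies resolution
(Zariski's patching). The tree's Kollár layer (`PrincipalizationToResolution.lean`, Kollár 2007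
(3.21) ⟹ (3.22) ⟹ resolution of all varieties, with Chow's lemma proved) uses characteristic
zero ONLY through the principalization theorem; its characteristic-free port
(`PrincipalizationToResolutionInChar.lean`, `resolutionInChar_of_kollarPrincipalizationOver`)
therefore turns Kollár-format principalization over all fields of characteristic `p`
(`KollarPrincipalizationOver k`: every proper closed subscheme of a regular variety over `k` is
principalized by a sequence of proper modifications with regular centres over it, regular end,
an isomorphism off it) into `ResolutionInChar p` — and hence into the crux, with the local
uniformization hypothesis IDLE.

This is recorded as a capstone of the line for the planner's benefit: together with the
no-slack theorems of the tree (`PatchingRel ↔ ∀ p prime, LUrel_p → SandwichedLocusResolution p`;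
`ResolutionInChar p ↔ TwoModelPatching p ∧ LUrel_p`) it shows that every sufficient condition in
sight for the line's atom — strong or weak resolution of sandwiched varieties, in abstract or
blow-up format, or embedded principalization à la Hironaka/Kollár — is a resolution theorem in
dimension `≥ 4` and positive characteristic, i.e. the crux is summit-equivalent in practice.

* `stub_resolutionInChar_of_kollarPrincipalizationOver` (registered stub K1: the universe-`0`
  instance of the Literature theorem) and the capstone `patchingRel_of_kollarPrincipalizationOver`
  with its `CyclicCovers` twin.

## References

* J. Kollár, *Lectures on Resolution of Singularities*, Ann. of Math. Stud. 166 (2007),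
  Thm. 3.21, Cor. 3.22 and its proof (pp. 124–125). [Kollar2007]
* O. Piltant, *An axiomatic version of Zariski's patching theorem*, RACSAM 107 (2013) 91–121,
  p. 2 (the implication LU ⇒ resolution is open in dimension ≥ 4). [Piltant2013]
-/

-- `Summit.<Summit>.<Sub>.Theorems` with `Sub = Summit` (single-conjunct summit, D-0017): the
-- duplicated namespace component is the tree layout.
set_option linter.dupNamespace false

noncomputable section

namespace Summit.ResolutionOfSingularities.ResolutionOfSingularities.Theorems

open Literature.AlgebraicGeometry.Resolution

/-- **Registered stub K1 of line `sandwiched-gluing`** (crux stmt-ResolutionOfSingularities-0642,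
universe `0`): Kollár-format principalization (Kollár 2007, Thm. 3.21, weak form) over all fields
of characteristic `p` gives `ResolutionInChar p` (Kollár's (3.21) ⟹ (3.22) ⟹ resolution of all
varieties via Chow's lemma is characteristic-free, `resolutionInChar_of_kollarPrincipalizationOver`).
[cite: Kollar2007, Thm. 3.21 and Cor. 3.22 (pp. 124–125)] -/
theorem stub_resolutionInChar_of_kollarPrincipalizationOver :
    ∀ p : ℕ, (∀ (k : Type) [Field k] [CharP k p],
      Literature.AlgebraicGeometry.Resolution.KollarPrincipalizationOver.{0} k) →
      ResolutionInChar.{0} p :=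
  fun _ h => resolutionInChar_of_kollarPrincipalizationOver h

/-- **Capstone K2 of line `sandwiched-gluing`** (crux stmt-ResolutionOfSingularities-0642):
Kollár-format principalization (Kollár 2007, Thm. 3.21, weak form, stated over fields of
characteristic `p`) for every prime `p` implies the crux `PatchingRel` — the conclusion
`ResolutionInChar p` follows outright (`resolutionInChar_of_kollarPrincipalizationOver`: Kollár's
(3.21) ⟹ (3.22) ⟹ resolution via Chow's lemma, characteristic-free), so the local-uniformization
hypothesis is not used. CONDITIONAL only on its explicit hypothesis (open for `p` prime in
dimension `≥ 4`). [cite: Kollar2007, Thm. 3.21 and Cor. 3.22 (pp. 124–125)] -/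
theorem patchingRel_of_kollarPrincipalizationOver :
    (∀ p : ℕ, p.Prime → ∀ (k : Type) [Field k] [CharP k p],
      Literature.AlgebraicGeometry.Resolution.KollarPrincipalizationOver.{0} k) →
    Summit.ResolutionOfSingularities.ResolutionOfSingularities.Theses.Valuative.PatchingRel :=
  fun h p hp _ => stub_resolutionInChar_of_kollarPrincipalizationOver p (h p hp)

/-- The same for the `CyclicCovers` copy of the crux (the same term). [cite: Kollar2007, Thm. 3.21 and Cor. 3.22 (pp. 124–125)] -/
theorem cyclicCovers_patchingRel_of_kollarPrincipalizationOver :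
    (∀ p : ℕ, p.Prime → ∀ (k : Type) [Field k] [CharP k p],
      Literature.AlgebraicGeometry.Resolution.KollarPrincipalizationOver.{0} k) →
    Summit.ResolutionOfSingularities.ResolutionOfSingularities.Theses.CyclicCovers.PatchingRel :=
  patchingRel_of_kollarPrincipalizationOver

end Summit.ResolutionOfSingularities.ResolutionOfSingularities.Theorems

end
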